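import Summits.QuantumFields.BalabanUV.Beta.FP.KernelPeriodisationFibHessKer
import Summits.QuantumFields.BalabanUV.Beta.FP.TorusCompositeObjects
import Summits.QuantumFields.BalabanUV.Beta.AxialDressingRootedBmHessian

/-!
# `BalabanUV.Beta.FP.KernelPeriodisationFibHessKerTower` — road «FP» (binder row D1), ROUTE T, (T-PER) PART 4‴ AT THE TOWER: **(P2‴) ON #41d's BOXES** —
# `KernelPeriodisationFibHessKer.hessKer_law_of_torus_hessT_law` SPECIALISED to the box sequences of the `j ≥ 2` assembly (the OWNER d1-p3 g27's SPEC #42 (4)):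
# the two fine systems `N`, `F` live on the finest torus `towerTorus Lc (M′ k) (n+1)` of leaf-06's tower over a growing `Lc`-divisible box sequence `M′ k`,
# the coarse system `G` on `M′ k` itself; the growth clauses of the two tower sequences and the three period-lattice invariances are DISCHARGED here from
# `hM′ : ∀ N, ∀ᶠ k, ∀ i, N ≤ M′ k i`, `hLcM′ : ∀ k i, Lc ∣ M′ k i` and the legs' BLOCK-TRANSLATION COVARIANCES at blockings `Lc^{n+2}` ∕ `Lc^{n+1}` ∕ `Lc`
# (an2's `CompositeOneShotChart.tower_shiftK_A` shape for the composite one-shot charts; `AxialDressingRootedBmHessian.shiftK_coDressKBmAt_KInvStep` for `G`)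

WHY (SPEC #42 (4), `HOME/b2b-balaban-beta-d1-p3/g27/SPEC-42.md`: «DE-PERIODISATION: (P2‴) `hessKer_law_of_torus_hessT_law` along a box sequence `k ↦ M′_k`
(`Lc ∣ M′_k`, `M′_k → ∞`): `MkN k = MkF k = towerTorus Lc (M′_k) (n+1)`, `MkG k = M′_k`; its `hlaw k` IS #41d's conclusion at box `k`»).  #41d
`TowerLawFullIndex.hessT_fullIndex_law_tower` concludes, at ONE top box `M′` with `hM′ : ∀ i, Lc ∣ M′ i`,
`hessT (perF T A_N) V_N V′_N W_N = hessT (perF T A_F) V_F V′_F W_F + hessT (perF M′ A_G) V_G V′_G W_G`, `T = towerTorus Lc M′ (n+1)`; once the (C1) namings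
write the jets as `V_X := perF T_X (dper T_X (𝒱_X μ 0))` etc. (SPEC #42 (1)), (P2‴) wants per system a growth clause for ITS box sequence and the
`T_X ℤ^{d+1}`-invariance of its leg at EVERY `k`.  For the tower these are NOT hypotheses: `towerTorus Lc M n i = Lc^n · M i` (`TorusCompositeObjects.towerTorus_apply`),
so `M′ k → ∞ ⟹ towerTorus Lc (M′ k) (n+1) → ∞`, `Lc^{n+1} ∣ T i` always and `Lc^{n+2} ∣ T i` under `Lc ∣ M′ i`; and a leg that is block-translation covariant at
blocking `P` is `Mℤ^{d+1}`-invariant on every box with `P ∣ M i` (`KernelPeriodisationFib.translate_invariant_of_shiftK`).  The blockings of record: the `N` system's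
composite one-shot chart at scale `bigRatio Lc (n+1) = Lc^{n+2}`, the `F` system's at `bigRatio Lc n = Lc^{n+1}` (an2 W-an2-g49-3, `CompositeOneShotChart` §2:
`tower_shiftK_A … : shiftK (((Lc ^ (m + 1) : ℕ) : ℤ) • t) A = A`), `G`'s rooted co-dressed step resolvent at `Lc` (`shiftK_coDressKBmAt_KInvStep`, stated at `-(Lc • t)`:
§1 `shiftK_smul_of_neg` flips it).
CONTENT ([folklore]; no `def`, no `def … : Prop`, nothing cited, 0 sorry; 0 estimates):
* §1 box letters of the tower: `pow_dvd_towerTorus` (`Lc^n ∣ towerTorus Lc M n i`), `pow_succ_dvd_towerTorus` (`Lc ∣ M i ⟹ Lc^{n+1} ∣ towerTorus Lc M n i`),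
  `le_towerTorus`, **`eventually_le_towerTorus`** (#23's growth sentence passes from `M′ k` to `towerTorus Lc (M′ k) n`), `shiftK_smul_of_neg`,
  `translate_invariant_towerTorus_of_shiftK` (blocking `Lc^{n+1}` ∕ `Lc^{n+2}` ⟹ invariance on the tower's finest torus).
* §2 **`hessKer_law_of_tower_hessT_law`**: (P2‴)'s §4 with `MkN = MkF := k ↦ towerTorus Lc (M′ k) (n+1)`, `MkG := M′`; displayed: `hM′`, `hLcM′`, the three legs'
  decay + block-translation covariance (blockings `Lc^{n+2}`, `Lc^{n+1}`, `Lc`), the jets' bi-localisations VERBATIM as in (P2‴), and `hlaw k` = #41d's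
  conclusion SHAPE at box `M′ k` with the jets written `perF (·) (dper (·) (𝒱_X …))`; conclusion `hessKer A_N 𝒱_N 𝒲_N μ ν z = hessKer A_F … + hessKer A_G …`.
  The OWNER's (P2‴) call (SPEC #42 «ONE term per `(j, μ, ν, z)`») is this theorem with `hlaw k :=` #41d at box `k` after the namings.
* §3 **`hessKer_law_of_tower_hessT_law_coDress`**: §2 with the `G` leg PINNED to #41d's top-comb chart kernel `coDressKBmAt (toSite r) Lc (KInvStep Lc j)`
  (`r ∈ box (d+1) Lc`, any level `j`; at #41d `r := rs 0`, `j := lev 0`): its decay and its blocking-`Lc` covariance DISCHARGED by an2's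
  `AxialDressingRootedBmHessian.decays_coDressKBmAt_KInvStep ∕ shiftK_coDressKBmAt_KInvStep` BY NAME — only the two composite one-shot charts' letters
  and the jets stay displayed.
What it is NOT: not the namings (an2's (C1) F1–F6), not the legs' decay constants (the composite charts' `Decays` letters are the row's), not the identifications
(L2′), not #28 §4.  Moves NO (CONV-C) clause and NO row-D1 binder; NOT (T-ID), NOT SDF, NOT D1, NOT BetaPertH, NOT continuum, NOT Clay.

HONEST DEPENDENCY (page 1, mandatory): continuum YM on T⁴ ⇐ BetaPertH ∧ nine spine estimates (0/9 proved); BetaPertH ⇐ (D1) ∧ (D4) ∧ CAP+tail;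
G-an2-4 gates asym, D1 and NE2/3/4.  HONEST FRAMING (cell contract, verbatim): «discharging `BetaPertH` makes Bałaban's UV stability UNCONDITIONAL —
a real constructive-QFT result; it is NOT the continuum limit and NOT the Clay problem.»  ABSOLUTE RULE (cell charter, verbatim): «No internally-minted
statement may enter as a cited fact. Every hypothesis is either kernel-proved in this package or a verbatim quotation of a PUBLISHED theorem with page
reference. The manuscript(s) under audit are NOT citable for their own disputed steps — they are the thing under adjudication; programme-internal
(2001/route/tribunal) claims are never citable.»  Nothing of Bałaban's asserted.  D1 formalisation swarm LEAF PROVER 06 (b2b-balaban-beta-d1-formalise-leaf-06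
gen 29), 2026-08-23.  No existing file touched.
-/

noncomputable section

open scoped BigOperators Matrix Topology
open Finset Filter

namespace Summit.QuantumFields.BalabanUV.Beta.FP.KernelPeriodisationFibHessKerTower

open Literature.MathematicalPhysics.QuantumFieldTheory.Balaban1983to89
open Literature.MathematicalPhysics.QuantumFieldTheory.Balaban1983to89.Beta
open B4TorusKernel.MultiPeriod (translate)
open B5Prop11Plancherel (fine)
open ExpKernelCalculus (MKer Decays BiLoc shiftK hessKer)
open Summit.QuantumFields.BalabanUV.Beta.D1BFx.MixedVarPackedHess (hessT)
open Summit.QuantumFields.BalabanUV.Beta.FP.KernelPeriodisationFib (perF translate_invariant_of_shiftK)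
open Summit.QuantumFields.BalabanUV.Beta.FP.KernelPeriodisationFibLoc (dper)
open Summit.QuantumFields.BalabanUV.Beta.FP.KernelPeriodisationFibHessKer (hessKer_law_of_torus_hessT_law)
open Summit.QuantumFields.BalabanUV.Beta.FP.TorusCompositeObjects (towerTorus towerTorus_apply)
open AffineAveraging (box toSite)
open OneStepResolventKernel (Fib)
open OneStepKernelFamily (KInvStep)
open Summit.QuantumFields.BalabanUV.Beta.AxialDressingRooted (coDressKBmAt decays_coDressKBmAt_KInvStep shiftK_coDressKBmAt_KInvStep)

variable {d : ℕ}

/-! ## §1 Box letters of the tower -/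

section Boxes

variable (Lc : ℕ)

/-- [folklore] the finest torus of the depth-`n` tower is `Lc^n`-divisible (`towerTorus Lc M n i = Lc^n · M i`). -/
theorem pow_dvd_towerTorus (M : Fin (d + 1) → ℕ) (n : ℕ) (i : Fin (d + 1)) : Lc ^ n ∣ towerTorus Lc M n i := by
  rw [towerTorus_apply]; exact dvd_mul_right _ _

/-- [folklore] … and `Lc^{n+1}`-divisible when the top torus is `Lc`-divisible (#41d's `hM′ : ∀ i, Lc ∣ M′ i`). -/
theorem pow_succ_dvd_towerTorus (M : Fin (d + 1) → ℕ) (hM : ∀ i, Lc ∣ M i) (n : ℕ) (i : Fin (d + 1)) :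
    Lc ^ (n + 1) ∣ towerTorus Lc M n i := by
  rw [towerTorus_apply, pow_succ]; exact mul_dvd_mul_left _ (hM i)

/-- [folklore] the finest torus dominates the top torus (`1 ≤ Lc`). -/
theorem le_towerTorus [NeZero Lc] (M : Fin (d + 1) → ℕ) (n : ℕ) (i : Fin (d + 1)) : M i ≤ towerTorus Lc M n i := by
  rw [towerTorus_apply]
  exact Nat.le_mul_of_pos_left _ (pow_pos (Nat.pos_of_ne_zero (NeZero.ne Lc)) _)

/-- [folklore] **#23's GROWTH SENTENCE PASSES TO THE TOWER**: if every period of `M′ k` is eventually `≥ N`, so is every period of `towerTorus Lc (M′ k) n`. -/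
theorem eventually_le_towerTorus [NeZero Lc] (M' : ℕ → (Fin (d + 1) → ℕ)) (hM' : ∀ N : ℕ, ∀ᶠ k in atTop, ∀ i, N ≤ M' k i)
    (n N : ℕ) : ∀ᶠ k in atTop, ∀ i, N ≤ towerTorus Lc (M' k) n i :=
  (hM' N).mono fun k hk i => (hk i).trans (le_towerTorus Lc (M' k) n i)

variable {Lc}

/-- [folklore] sign flip for a block-translation covariance stated at `-(c • t)` (`AxialDressingRootedBmHessian.shiftK_coDressKBmAt_KInvStep`'s shape). -/
theorem shiftK_smul_of_neg {F : Type*} {K : MKer (d + 1) F} {c : ℤ} (hK : ∀ t : Fin (d + 1) → ℤ, shiftK (-(c • t)) K = K)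
    (t : Fin (d + 1) → ℤ) : shiftK (c • t) K = K := by
  have h := hK (-t)
  rwa [smul_neg, neg_neg] at h

/-- [folklore] **INVARIANCE ON THE TOWER's FINEST TORUS FROM BLOCK-TRANSLATION COVARIANCE AT BLOCKING `Lc^n`** (any top `M`). -/
theorem translate_invariant_towerTorus_of_shiftK {F : Type*} {K : MKer (d + 1) F} (M : Fin (d + 1) → ℕ) (n : ℕ)
    (hK : ∀ t : Fin (d + 1) → ℤ, shiftK (((Lc ^ n : ℕ) : ℤ) • t) K = K) (m x y : Fin (d + 1) → ℤ) (a b : F) :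
    K (translate (towerTorus Lc M n) x m) (translate (towerTorus Lc M n) y m) a b = K x y a b :=
  translate_invariant_of_shiftK (towerTorus Lc M n) hK (pow_dvd_towerTorus Lc M n) m x y a b

/-- [folklore] **… AND AT BLOCKING `Lc^{n+1}` WHEN `Lc ∣ M`** (the `N` system's chart on `towerTorus Lc M′ (n+1)`, blocking `Lc^{n+2}`). -/
theorem translate_invariant_towerTorus_of_shiftK_succ {F : Type*} {K : MKer (d + 1) F} (M : Fin (d + 1) → ℕ) (hM : ∀ i, Lc ∣ M i) (n : ℕ)
    (hK : ∀ t : Fin (d + 1) → ℤ, shiftK (((Lc ^ (n + 1) : ℕ) : ℤ) • t) K = K) (m x y : Fin (d + 1) → ℤ) (a b : F) :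
    K (translate (towerTorus Lc M n) x m) (translate (towerTorus Lc M n) y m) a b = K x y a b :=
  translate_invariant_of_shiftK (towerTorus Lc M n) hK (pow_succ_dvd_towerTorus Lc M hM n) m x y a b

end Boxes

/-! ## §2 (P2‴) on the tower's boxes -/

section Law

variable {FN FF FG : Type*} [Fintype FN] [Fintype FF] [Fintype FG]
variable {AN : MKer (d + 1) FN} {AF : MKer (d + 1) FF} {AG : MKer (d + 1) FG}
  {CAN αN CAF αF CAG αG δN δF δG CvN CvN' CwN CvF CvF' CwF CvG CvG' CwG : ℝ}
  {pN pN' qN qN' pF pF' qF qF' pG pG' qG qG' : Fin (d + 1) → ℤ}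

/-- [folklore] **`hessKer_law_of_tower_hessT_law` — (P2‴) ON #41d's BOXES.**  A growing `Lc`-divisible box sequence `M′ k` (`hM′`, `hLcM′`); depth `n`; three
legs `A_N A_F A_G` decaying and block-translation covariant at blockings `Lc^{n+2}` ∕ `Lc^{n+1}` ∕ `Lc` (the composite one-shot charts' `tower_shiftK_A`
shape at `m := n+1` ∕ `m := n`; `G`'s `shiftK_coDressKBmAt_KInvStep` through `shiftK_smul_of_neg`); base-point jet families bi-localised as in (P2‴) §3;
and AT EVERY `k` the torus one-loop law of #41d's SHAPE — the two fine systems on `towerTorus Lc (M′ k) (n+1)`, the coarse one on `M′ k`, jets written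
`perF · (dper · (𝒱_X …))` —; THEN `hessKer A_N 𝒱_N 𝒲_N μ ν z = hessKer A_F 𝒱_F 𝒲_F μ ν z + hessKer A_G 𝒱_G 𝒲_G μ ν z`.
(= `hessKer_law_of_torus_hessT_law` at `MkN = MkF := k ↦ towerTorus Lc (M′ k) (n+1)`, `MkG := M′`, growth by `eventually_le_towerTorus`, invariances by §1.) -/
theorem hessKer_law_of_tower_hessT_law (Lc : ℕ) [NeZero Lc] (M' : ℕ → (Fin (d + 1) → ℕ)) [∀ k μ, NeZero (M' k μ)]
    (hM' : ∀ N : ℕ, ∀ᶠ k in atTop, ∀ i, N ≤ M' k i) (hLcM' : ∀ k i, Lc ∣ M' k i) (n : ℕ)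
    (𝒱N : Fin (d + 1) → (Fin (d + 1) → ℤ) → MKer (d + 1) FN) (𝒱F : Fin (d + 1) → (Fin (d + 1) → ℤ) → MKer (d + 1) FF)
    (𝒱G : Fin (d + 1) → (Fin (d + 1) → ℤ) → MKer (d + 1) FG)
    (𝒲N : Fin (d + 1) → (Fin (d + 1) → ℤ) → Fin (d + 1) → (Fin (d + 1) → ℤ) → MKer (d + 1) FN)
    (𝒲F : Fin (d + 1) → (Fin (d + 1) → ℤ) → Fin (d + 1) → (Fin (d + 1) → ℤ) → MKer (d + 1) FF)
    (𝒲G : Fin (d + 1) → (Fin (d + 1) → ℤ) → Fin (d + 1) → (Fin (d + 1) → ℤ) → MKer (d + 1) FG)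
    (μ ν : Fin (d + 1)) (z : Fin (d + 1) → ℤ)
    -- `N`: the depth-`(n+2)` composite one-shot system on `towerTorus Lc (M′ k) (n+1)`, blocking `Lc^{n+2}`
    (hAN : Decays AN CAN αN) (hαN : 0 < αN) (hANsh : ∀ t : Fin (d + 1) → ℤ, shiftK (((Lc ^ (n + 2) : ℕ) : ℤ) • t) AN = AN)
    (hVN : BiLoc (𝒱N μ 0) pN pN' CvN δN) (hVN' : BiLoc (𝒱N ν z) qN' qN CvN' δN) (hWN : BiLoc (𝒲N μ 0 ν z) pN qN CwN δN) (hδN : 0 < δN)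
    -- `F`: the depth-`(n+1)` composite one-shot system on the SAME torus, blocking `Lc^{n+1}`
    (hAF : Decays AF CAF αF) (hαF : 0 < αF) (hAFsh : ∀ t : Fin (d + 1) → ℤ, shiftK (((Lc ^ (n + 1) : ℕ) : ℤ) • t) AF = AF)
    (hVF : BiLoc (𝒱F μ 0) pF pF' CvF δF) (hVF' : BiLoc (𝒱F ν z) qF' qF CvF' δF) (hWF : BiLoc (𝒲F μ 0 ν z) pF qF CwF δF) (hδF : 0 < δF)
    -- `G`: the top step's rooted co-dressed resolvent on `M′ k`, blocking `Lc`
    (hAG : Decays AG CAG αG) (hαG : 0 < αG) (hAGsh : ∀ t : Fin (d + 1) → ℤ, shiftK ((Lc : ℤ) • t) AG = AG)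
    (hVG : BiLoc (𝒱G μ 0) pG pG' CvG δG) (hVG' : BiLoc (𝒱G ν z) qG' qG CvG' δG) (hWG : BiLoc (𝒲G μ 0 ν z) pG qG CwG δG) (hδG : 0 < δG)
    -- #41d's conclusion SHAPE at every box `M′ k`, jets named `perF · (dper · 𝒱_X …)`
    (hlaw : ∀ k,
      hessT (perF (towerTorus Lc (M' k) (n + 1)) AN) (perF (towerTorus Lc (M' k) (n + 1)) (dper (towerTorus Lc (M' k) (n + 1)) (𝒱N μ 0)))
          (perF (towerTorus Lc (M' k) (n + 1)) (dper (towerTorus Lc (M' k) (n + 1)) (𝒱N ν z)))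
          (perF (towerTorus Lc (M' k) (n + 1)) (dper (towerTorus Lc (M' k) (n + 1)) (𝒲N μ 0 ν z))) =
        hessT (perF (towerTorus Lc (M' k) (n + 1)) AF) (perF (towerTorus Lc (M' k) (n + 1)) (dper (towerTorus Lc (M' k) (n + 1)) (𝒱F μ 0)))
            (perF (towerTorus Lc (M' k) (n + 1)) (dper (towerTorus Lc (M' k) (n + 1)) (𝒱F ν z)))
            (perF (towerTorus Lc (M' k) (n + 1)) (dper (towerTorus Lc (M' k) (n + 1)) (𝒲F μ 0 ν z))) +
          hessT (perF (M' k) AG) (perF (M' k) (dper (M' k) (𝒱G μ 0))) (perF (M' k) (dper (M' k) (𝒱G ν z)))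
            (perF (M' k) (dper (M' k) (𝒲G μ 0 ν z)))) :
    hessKer AN 𝒱N 𝒲N μ ν z = hessKer AF 𝒱F 𝒲F μ ν z + hessKer AG 𝒱G 𝒲G μ ν z :=
  hessKer_law_of_torus_hessT_law (fun k => towerTorus Lc (M' k) (n + 1)) (fun k => towerTorus Lc (M' k) (n + 1)) M'
    (fun N => eventually_le_towerTorus Lc M' hM' (n + 1) N) (fun N => eventually_le_towerTorus Lc M' hM' (n + 1) N) hM'
    𝒱N 𝒱F 𝒱G 𝒲N 𝒲F 𝒲G μ ν z
    hAN hαN (fun k m x y a b => translate_invariant_towerTorus_of_shiftK_succ (M' k) (hLcM' k) (n + 1) hANsh m x y a b)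
    hVN hVN' hWN hδN
    hAF hαF (fun k m x y a b => translate_invariant_towerTorus_of_shiftK (M' k) (n + 1) hAFsh m x y a b)
    hVF hVF' hWF hδF
    hAG hαG (fun k m x y a b => translate_invariant_of_shiftK (M' k) hAGsh (hLcM' k) m x y a b)
    hVG hVG' hWG hδG hlaw

/-- [folklore] **`hessKer_law_of_tower_hessT_law_coDress` — §2 WITH THE `G` LEG PINNED TO #41d's TOP-COMB CHART KERNEL** `coDressKBmAt (toSite r) Lc (KInvStep Lc j)`
(`r ∈ box (d+1) Lc`; at #41d `r := rs 0`, `j := lev 0`): its decay (`decays_coDressKBmAt_KInvStep`) and its blocking-`Lc` covariance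
(`shiftK_coDressKBmAt_KInvStep`, flipped by `shiftK_smul_of_neg`) are an2's theorems BY NAME, so only the composite one-shot charts' decay ∕ covariance
letters and the jets' bi-localisations remain displayed. -/
theorem hessKer_law_of_tower_hessT_law_coDress (Lc : ℕ) [NeZero Lc] (M' : ℕ → (Fin (d + 1) → ℕ)) [∀ k μ, NeZero (M' k μ)]
    (hM' : ∀ N : ℕ, ∀ᶠ k in atTop, ∀ i, N ≤ M' k i) (hLcM' : ∀ k i, Lc ∣ M' k i) (n : ℕ)
    {r : Fin (d + 1) → ℕ} (hr : r ∈ box (d + 1) Lc) (j : ℕ)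
    (𝒱N : Fin (d + 1) → (Fin (d + 1) → ℤ) → MKer (d + 1) FN) (𝒱F : Fin (d + 1) → (Fin (d + 1) → ℤ) → MKer (d + 1) FF)
    (𝒱G : Fin (d + 1) → (Fin (d + 1) → ℤ) → MKer (d + 1) (Fib d))
    (𝒲N : Fin (d + 1) → (Fin (d + 1) → ℤ) → Fin (d + 1) → (Fin (d + 1) → ℤ) → MKer (d + 1) FN)
    (𝒲F : Fin (d + 1) → (Fin (d + 1) → ℤ) → Fin (d + 1) → (Fin (d + 1) → ℤ) → MKer (d + 1) FF)
    (𝒲G : Fin (d + 1) → (Fin (d + 1) → ℤ) → Fin (d + 1) → (Fin (d + 1) → ℤ) → MKer (d + 1) (Fib d))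
    (μ ν : Fin (d + 1)) (z : Fin (d + 1) → ℤ)
    (hAN : Decays AN CAN αN) (hαN : 0 < αN) (hANsh : ∀ t : Fin (d + 1) → ℤ, shiftK (((Lc ^ (n + 2) : ℕ) : ℤ) • t) AN = AN)
    (hVN : BiLoc (𝒱N μ 0) pN pN' CvN δN) (hVN' : BiLoc (𝒱N ν z) qN' qN CvN' δN) (hWN : BiLoc (𝒲N μ 0 ν z) pN qN CwN δN) (hδN : 0 < δN)
    (hAF : Decays AF CAF αF) (hαF : 0 < αF) (hAFsh : ∀ t : Fin (d + 1) → ℤ, shiftK (((Lc ^ (n + 1) : ℕ) : ℤ) • t) AF = AF)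
    (hVF : BiLoc (𝒱F μ 0) pF pF' CvF δF) (hVF' : BiLoc (𝒱F ν z) qF' qF CvF' δF) (hWF : BiLoc (𝒲F μ 0 ν z) pF qF CwF δF) (hδF : 0 < δF)
    (hVG : BiLoc (𝒱G μ 0) pG pG' CvG δG) (hVG' : BiLoc (𝒱G ν z) qG' qG CvG' δG) (hWG : BiLoc (𝒲G μ 0 ν z) pG qG CwG δG) (hδG : 0 < δG)
    (hlaw : ∀ k,
      hessT (perF (towerTorus Lc (M' k) (n + 1)) AN) (perF (towerTorus Lc (M' k) (n + 1)) (dper (towerTorus Lc (M' k) (n + 1)) (𝒱N μ 0)))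
          (perF (towerTorus Lc (M' k) (n + 1)) (dper (towerTorus Lc (M' k) (n + 1)) (𝒱N ν z)))
          (perF (towerTorus Lc (M' k) (n + 1)) (dper (towerTorus Lc (M' k) (n + 1)) (𝒲N μ 0 ν z))) =
        hessT (perF (towerTorus Lc (M' k) (n + 1)) AF) (perF (towerTorus Lc (M' k) (n + 1)) (dper (towerTorus Lc (M' k) (n + 1)) (𝒱F μ 0)))
            (perF (towerTorus Lc (M' k) (n + 1)) (dper (towerTorus Lc (M' k) (n + 1)) (𝒱F ν z)))
            (perF (towerTorus Lc (M' k) (n + 1)) (dper (towerTorus Lc (M' k) (n + 1)) (𝒲F μ 0 ν z))) +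
          hessT (perF (M' k) (coDressKBmAt (toSite r) Lc (KInvStep (d := d) Lc j))) (perF (M' k) (dper (M' k) (𝒱G μ 0)))
            (perF (M' k) (dper (M' k) (𝒱G ν z))) (perF (M' k) (dper (M' k) (𝒲G μ 0 ν z)))) :
    hessKer AN 𝒱N 𝒲N μ ν z =
      hessKer AF 𝒱F 𝒲F μ ν z + hessKer (coDressKBmAt (toSite r) Lc (KInvStep (d := d) Lc j)) 𝒱G 𝒲G μ ν z := by
  obtain ⟨δ, C, hδ, -, hD⟩ := decays_coDressKBmAt_KInvStep (d := d) hr j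
  exact hessKer_law_of_tower_hessT_law Lc M' hM' hLcM' n 𝒱N 𝒱F 𝒱G 𝒲N 𝒲F 𝒲G μ ν z hAN hαN hANsh hVN hVN' hWN hδN
    hAF hαF hAFsh hVF hVF' hWF hδF hD hδ (shiftK_smul_of_neg fun t => shiftK_coDressKBmAt_KInvStep (toSite r) j t)
    hVG hVG' hWG hδG hlaw

/-- [folklore] shape check (zero weight): the `N` blocking `Lc ^ (n + 2)` IS an2's `tower_shiftK_A (m := n + 1)` blocking `Lc ^ (n + 1 + 1)` and the `F`
blocking `Lc ^ (n + 1)` IS `tower_shiftK_A (m := n)`'s, definitionally. -/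
example (Lc n : ℕ) (P : ℕ → Prop) (hN : P (Lc ^ (n + 1 + 1))) : P (Lc ^ (n + 2)) := hN

end Law

/-! ## §4 The same with the torus law holding only EVENTUALLY in the box index

leaf-02 g29's located letter W-2 (HOME/CLAIMS.log l.55279; an2 g49 W-12 (b) l.55303 «agreed in substance»): the ORDER-2 (C1) naming clauses that turn
#41d's displayed torus jets into `perF T (dper T (𝒲_X μ 0 ν z))` hold only on boxes beyond some `K₀(μ, ν, z)` (wrap-around pairs are real on small boxes),
so at the record the torus law in (P2‴)'s currency is available `∀ᶠ k in atTop`, not `∀ k`.  De-periodisation needs no more: limits along `atTop` see only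
tails.  The two theorems below are §2's with `hlaw : ∀ᶠ k in atTop, …` (`Filter.Tendsto.congr'` + `tendsto_nhds_unique` on (P2‴) §3's three limits);
the `∀ k` forms above are their special case, and the TAIL-SEQUENCE instantiation `fun K => M′ (K + K₀)` of §2 (an2's stated preference) stays available. -/

section LawEventually

open Summit.QuantumFields.BalabanUV.Beta.FP.KernelPeriodisationFibHessKer (tendsto_hessT_perF_hessKer)

variable {FN FF FG : Type*} [Fintype FN] [Fintype FF] [Fintype FG]
variable {AN : MKer (d + 1) FN} {AF : MKer (d + 1) FF} {AG : MKer (d + 1) FG}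
  {CAN αN CAF αF CAG αG δN δF δG CvN CvN' CwN CvF CvF' CwF CvG CvG' CwG : ℝ}
  {pN pN' qN qN' pF pF' qF qF' pG pG' qG qG' : Fin (d + 1) → ℤ}

/-- [folklore] **`hessKer_law_of_tower_hessT_law_eventually`** — §2 `hessKer_law_of_tower_hessT_law` with the torus law assumed only for all
sufficiently large boxes: `hlaw : ∀ᶠ k in atTop, hessT_N k = hessT_F k + hessT_G k` ⟹ `hessKer A_N 𝒱_N 𝒲_N μ ν z = hessKer A_F … + hessKer A_G …`. -/
theorem hessKer_law_of_tower_hessT_law_eventually (Lc : ℕ) [NeZero Lc] (M' : ℕ → (Fin (d + 1) → ℕ)) [∀ k μ, NeZero (M' k μ)]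
    (hM' : ∀ N : ℕ, ∀ᶠ k in atTop, ∀ i, N ≤ M' k i) (hLcM' : ∀ k i, Lc ∣ M' k i) (n : ℕ)
    (𝒱N : Fin (d + 1) → (Fin (d + 1) → ℤ) → MKer (d + 1) FN) (𝒱F : Fin (d + 1) → (Fin (d + 1) → ℤ) → MKer (d + 1) FF)
    (𝒱G : Fin (d + 1) → (Fin (d + 1) → ℤ) → MKer (d + 1) FG)
    (𝒲N : Fin (d + 1) → (Fin (d + 1) → ℤ) → Fin (d + 1) → (Fin (d + 1) → ℤ) → MKer (d + 1) FN)
    (𝒲F : Fin (d + 1) → (Fin (d + 1) → ℤ) → Fin (d + 1) → (Fin (d + 1) → ℤ) → MKer (d + 1) FF)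
    (𝒲G : Fin (d + 1) → (Fin (d + 1) → ℤ) → Fin (d + 1) → (Fin (d + 1) → ℤ) → MKer (d + 1) FG)
    (μ ν : Fin (d + 1)) (z : Fin (d + 1) → ℤ)
    (hAN : Decays AN CAN αN) (hαN : 0 < αN) (hANsh : ∀ t : Fin (d + 1) → ℤ, shiftK (((Lc ^ (n + 2) : ℕ) : ℤ) • t) AN = AN)
    (hVN : BiLoc (𝒱N μ 0) pN pN' CvN δN) (hVN' : BiLoc (𝒱N ν z) qN' qN CvN' δN) (hWN : BiLoc (𝒲N μ 0 ν z) pN qN CwN δN) (hδN : 0 < δN)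
    (hAF : Decays AF CAF αF) (hαF : 0 < αF) (hAFsh : ∀ t : Fin (d + 1) → ℤ, shiftK (((Lc ^ (n + 1) : ℕ) : ℤ) • t) AF = AF)
    (hVF : BiLoc (𝒱F μ 0) pF pF' CvF δF) (hVF' : BiLoc (𝒱F ν z) qF' qF CvF' δF) (hWF : BiLoc (𝒲F μ 0 ν z) pF qF CwF δF) (hδF : 0 < δF)
    (hAG : Decays AG CAG αG) (hαG : 0 < αG) (hAGsh : ∀ t : Fin (d + 1) → ℤ, shiftK ((Lc : ℤ) • t) AG = AG)
    (hVG : BiLoc (𝒱G μ 0) pG pG' CvG δG) (hVG' : BiLoc (𝒱G ν z) qG' qG CvG' δG) (hWG : BiLoc (𝒲G μ 0 ν z) pG qG CwG δG) (hδG : 0 < δG)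
    (hlaw : ∀ᶠ k in atTop,
      hessT (perF (towerTorus Lc (M' k) (n + 1)) AN) (perF (towerTorus Lc (M' k) (n + 1)) (dper (towerTorus Lc (M' k) (n + 1)) (𝒱N μ 0)))
          (perF (towerTorus Lc (M' k) (n + 1)) (dper (towerTorus Lc (M' k) (n + 1)) (𝒱N ν z)))
          (perF (towerTorus Lc (M' k) (n + 1)) (dper (towerTorus Lc (M' k) (n + 1)) (𝒲N μ 0 ν z))) =
        hessT (perF (towerTorus Lc (M' k) (n + 1)) AF) (perF (towerTorus Lc (M' k) (n + 1)) (dper (towerTorus Lc (M' k) (n + 1)) (𝒱F μ 0)))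
            (perF (towerTorus Lc (M' k) (n + 1)) (dper (towerTorus Lc (M' k) (n + 1)) (𝒱F ν z)))
            (perF (towerTorus Lc (M' k) (n + 1)) (dper (towerTorus Lc (M' k) (n + 1)) (𝒲F μ 0 ν z))) +
          hessT (perF (M' k) AG) (perF (M' k) (dper (M' k) (𝒱G μ 0))) (perF (M' k) (dper (M' k) (𝒱G ν z)))
            (perF (M' k) (dper (M' k) (𝒲G μ 0 ν z)))) :
    hessKer AN 𝒱N 𝒲N μ ν z = hessKer AF 𝒱F 𝒲F μ ν z + hessKer AG 𝒱G 𝒲G μ ν z := by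
  have hN := tendsto_hessT_perF_hessKer (fun k => towerTorus Lc (M' k) (n + 1))
    (fun N => eventually_le_towerTorus Lc M' hM' (n + 1) N) hAN hαN
    (fun k m x y a b => translate_invariant_towerTorus_of_shiftK_succ (M' k) (hLcM' k) (n + 1) hANsh m x y a b) 𝒱N 𝒲N μ ν z
    hVN hVN' hWN hδN
  have hF := tendsto_hessT_perF_hessKer (fun k => towerTorus Lc (M' k) (n + 1))
    (fun N => eventually_le_towerTorus Lc M' hM' (n + 1) N) hAF hαF
    (fun k m x y a b => translate_invariant_towerTorus_of_shiftK (M' k) (n + 1) hAFsh m x y a b) 𝒱F 𝒲F μ ν z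
    hVF hVF' hWF hδF
  have hG := tendsto_hessT_perF_hessKer M' hM' hAG hαG
    (fun k m x y a b => translate_invariant_of_shiftK (M' k) hAGsh (hLcM' k) m x y a b) 𝒱G 𝒲G μ ν z hVG hVG' hWG hδG
  exact tendsto_nhds_unique (Filter.Tendsto.congr' hlaw hN) (hF.add hG)

/-- [folklore] **`hessKer_law_of_tower_hessT_law_coDress_eventually`** — §2's `_coDress` form (the `G` leg PINNED to `coDressKBmAt (toSite r) Lc (KInvStep Lc j)`)
with the torus law assumed only `∀ᶠ k in atTop` — the socket for the OWNER's #42a when the order-2 (C1) clauses are stated on large boxes only. -/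
theorem hessKer_law_of_tower_hessT_law_coDress_eventually (Lc : ℕ) [NeZero Lc] (M' : ℕ → (Fin (d + 1) → ℕ)) [∀ k μ, NeZero (M' k μ)]
    (hM' : ∀ N : ℕ, ∀ᶠ k in atTop, ∀ i, N ≤ M' k i) (hLcM' : ∀ k i, Lc ∣ M' k i) (n : ℕ)
    {r : Fin (d + 1) → ℕ} (hr : r ∈ box (d + 1) Lc) (j : ℕ)
    (𝒱N : Fin (d + 1) → (Fin (d + 1) → ℤ) → MKer (d + 1) FN) (𝒱F : Fin (d + 1) → (Fin (d + 1) → ℤ) → MKer (d + 1) FF)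
    (𝒱G : Fin (d + 1) → (Fin (d + 1) → ℤ) → MKer (d + 1) (Fib d))
    (𝒲N : Fin (d + 1) → (Fin (d + 1) → ℤ) → Fin (d + 1) → (Fin (d + 1) → ℤ) → MKer (d + 1) FN)
    (𝒲F : Fin (d + 1) → (Fin (d + 1) → ℤ) → Fin (d + 1) → (Fin (d + 1) → ℤ) → MKer (d + 1) FF)
    (𝒲G : Fin (d + 1) → (Fin (d + 1) → ℤ) → Fin (d + 1) → (Fin (d + 1) → ℤ) → MKer (d + 1) (Fib d))
    (μ ν : Fin (d + 1)) (z : Fin (d + 1) → ℤ)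
    (hAN : Decays AN CAN αN) (hαN : 0 < αN) (hANsh : ∀ t : Fin (d + 1) → ℤ, shiftK (((Lc ^ (n + 2) : ℕ) : ℤ) • t) AN = AN)
    (hVN : BiLoc (𝒱N μ 0) pN pN' CvN δN) (hVN' : BiLoc (𝒱N ν z) qN' qN CvN' δN) (hWN : BiLoc (𝒲N μ 0 ν z) pN qN CwN δN) (hδN : 0 < δN)
    (hAF : Decays AF CAF αF) (hαF : 0 < αF) (hAFsh : ∀ t : Fin (d + 1) → ℤ, shiftK (((Lc ^ (n + 1) : ℕ) : ℤ) • t) AF = AF)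
    (hVF : BiLoc (𝒱F μ 0) pF pF' CvF δF) (hVF' : BiLoc (𝒱F ν z) qF' qF CvF' δF) (hWF : BiLoc (𝒲F μ 0 ν z) pF qF CwF δF) (hδF : 0 < δF)
    (hVG : BiLoc (𝒱G μ 0) pG pG' CvG δG) (hVG' : BiLoc (𝒱G ν z) qG' qG CvG' δG) (hWG : BiLoc (𝒲G μ 0 ν z) pG qG CwG δG) (hδG : 0 < δG)
    (hlaw : ∀ᶠ k in atTop,
      hessT (perF (towerTorus Lc (M' k) (n + 1)) AN) (perF (towerTorus Lc (M' k) (n + 1)) (dper (towerTorus Lc (M' k) (n + 1)) (𝒱N μ 0)))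
          (perF (towerTorus Lc (M' k) (n + 1)) (dper (towerTorus Lc (M' k) (n + 1)) (𝒱N ν z)))
          (perF (towerTorus Lc (M' k) (n + 1)) (dper (towerTorus Lc (M' k) (n + 1)) (𝒲N μ 0 ν z))) =
        hessT (perF (towerTorus Lc (M' k) (n + 1)) AF) (perF (towerTorus Lc (M' k) (n + 1)) (dper (towerTorus Lc (M' k) (n + 1)) (𝒱F μ 0)))
            (perF (towerTorus Lc (M' k) (n + 1)) (dper (towerTorus Lc (M' k) (n + 1)) (𝒱F ν z)))
            (perF (towerTorus Lc (M' k) (n + 1)) (dper (towerTorus Lc (M' k) (n + 1)) (𝒲F μ 0 ν z))) +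
          hessT (perF (M' k) (coDressKBmAt (toSite r) Lc (KInvStep (d := d) Lc j))) (perF (M' k) (dper (M' k) (𝒱G μ 0)))
            (perF (M' k) (dper (M' k) (𝒱G ν z))) (perF (M' k) (dper (M' k) (𝒲G μ 0 ν z)))) :
    hessKer AN 𝒱N 𝒲N μ ν z =
      hessKer AF 𝒱F 𝒲F μ ν z + hessKer (coDressKBmAt (toSite r) Lc (KInvStep (d := d) Lc j)) 𝒱G 𝒲G μ ν z := by
  obtain ⟨δ, C, hδ, -, hD⟩ := decays_coDressKBmAt_KInvStep (d := d) hr j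
  exact hessKer_law_of_tower_hessT_law_eventually Lc M' hM' hLcM' n 𝒱N 𝒱F 𝒱G 𝒲N 𝒲F 𝒲G μ ν z hAN hαN hANsh hVN hVN' hWN hδN
    hAF hαF hAFsh hVF hVF' hWF hδF hD hδ (shiftK_smul_of_neg fun t => shiftK_coDressKBmAt_KInvStep (toSite r) j t)
    hVG hVG' hWG hδG hlaw

end LawEventually

end Summit.QuantumFields.BalabanUV.Beta.FP.KernelPeriodisationFibHessKerTower

end
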